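import Summits.ResolutionOfSingularities.ResolutionOfSingularities.Theorems.FrobeniusLadderFInjectiveMacaulayficationCurveStageGlue
import Summits.ResolutionOfSingularities.ResolutionOfSingularities.Theorems.FrobeniusLadderFInjectiveMacaulayficationCurveStageFull
import Summits.ResolutionOfSingularities.ResolutionOfSingularities.Theorems.FrobeniusLadderFInjectiveMacaulayficationCentreSpread
import HarnessLib

/-!
# Curve stage, §C3 — THE PRODUCER: #3β at `η` from `LocFix(η)`, a spread `J` and the fibre condition `FC(η, J)`
# (crux `FInjectiveMacaulayfication` stmt-ResolutionOfSingularities-15315, chain w45a, hole #3β; U13 `CurveStageProducer`, file 3/3)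

[OURS · L1 W4.5a · res-D-pv-019 AS res-L1-w45a-stub-7] Support file (`--supports stmt-ResolutionOfSingularities-15315 --as helper`)
for the crux `FrobeniusLadder.FInjectiveMacaulayfication`; NOT a statement of any manuscript; AI-written, weaker than expert review.
Statement = §C3 `stub_closedLocusStep_of_locFix_of_fc` of strat-1's `L/res-L1-w45a-strat-1/CurveStageSig.lean` (HOLE-#3β
LOCAL-CURRENCY SIG OF RECORD, plan-1 R12.38 (a) «stub-7 U13 TARGET = §C3»; on-disk sha16 935ed93c8e42a36f, announced as
f81f934dfe54696f) VERBATIM with `stub_` dropped.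

THE THEOREM (`closedLocusStep_of_locFix_of_fc`, the census split «#3β(η) ⇐ LocFix(η) ∧ FC(η, J)» as ONE statement). For an
admissible `(X₁, f₁)`, a point `η` carrying the #3β hypothesis (verbatim, unused), LocFix data `(n, c)` — `(c) ≠ ⊥`, `(c) ≤ 𝔪_η`,
FULL clause on the charts `𝒪_η[(c)/c_j]` over `𝔪_η` — a spread `J ≠ ⊥` with `η ∈ supp J`, `J_η = (c)`, and the fibre condition
for every blowing up along `J` (FULL at the non-closed points over `supp J ∖ {η}`, Cohen–Macaulay at the closed points over
`supp J`) ⊢ the #3β ∃-clause at `η`. PROOF: a blowing up along `J` EXISTS (`Literature…BlowupsExistence.exists_isBlowup`, GW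
13.92, in the tree for every `IdealSheafData`); §C2 `CurveStageFull.full_over_of_locFix` (p522761) gives FULL over `η` itself,
which together with FC(nc) is FULL at every non-closed point over `supp J`; §C0 `CurveStageGlue.closedLocusStep_of_blowupDatum`
(p522237) assembles proper / birational / integral / Cohen–Macaulay / `Z := supp J`. (A corollary with the spread
PRODUCED by §C1 `CentreSpread.centreSpread`, res-type-002 p522543, follows by one `obtain`; appended when its olean is on the farm.) No named facts.
-/

-- single-problem summit: the doubled namespace component is forced
set_option linter.dupNamespace false

noncomputable section

open AlgebraicGeometry CategoryTheory Literature.AlgebraicGeometry.Resolution TopologicalSpace IsLocalRing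

namespace Summit.ResolutionOfSingularities.ResolutionOfSingularities.Theorems.FInjectiveMacaulayfication.CurveStageProducer

open Summit.ResolutionOfSingularities.ResolutionOfSingularities.Theorems.FInjectiveMacaulayfication

/-- **§C3 — THE CURVE-STAGE PRODUCER: #3β at `η` from LocFix(η) + a spread + FC(η, J)** (`CurveStageSig` §C3
`stub_closedLocusStep_of_locFix_of_fc`, verbatim): blow up along the spread `J` (existence: `exists_isBlowup`), get FULL over `η`
from the local fix (§C2) and over `supp J ∖ {η}` / CM at closed points from FC, and assemble with §C0. [folklore] -/
theorem closedLocusStep_of_locFix_of_fc : ∀ (p : ℕ), p.Prime → ∀ (k : Type) [Field k] [CharP k p]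
    (X₁ : Scheme.{0}) (f₁ : X₁ ⟶ Spec (.of k)),
      IsSeparated f₁ → LocallyOfFiniteType f₁ → QuasiCompact f₁ → IsIntegral X₁ →
      (∀ x : X₁, (∀ d : ℕ, ringKrullDim (X₁.presheaf.stalk x) = d → ∀ s : Fin d → X₁.presheaf.stalk x,
        (Ideal.span (Set.range s)).radical.IsMaximal → RingTheory.Sequence.IsWeaklyRegular (X₁.presheaf.stalk x) (List.ofFn s))) →
      ∀ η : X₁, (¬ IsClosed ({η} : Set X₁) ∧ ¬ (∀ d : ℕ, ringKrullDim (X₁.presheaf.stalk η) = d → ∀ s : Fin d → X₁.presheaf.stalk η,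
          (Ideal.span (Set.range s)).radical.IsMaximal → ∀ t : X₁.presheaf.stalk η, (∃ e : ℕ, t ^ p ^ e ∈
            Ideal.span ((fun z : X₁.presheaf.stalk η => z ^ p ^ e) '' (Ideal.span (Set.range s) : Set (X₁.presheaf.stalk η)))) →
              t ∈ Ideal.span (Set.range s)) ∧
        ∀ y : X₁, y ⤳ η → y ≠ η → (∀ d : ℕ, ringKrullDim (X₁.presheaf.stalk y) = d → ∀ s : Fin d → X₁.presheaf.stalk y,
          (Ideal.span (Set.range s)).radical.IsMaximal → ∀ t : X₁.presheaf.stalk y, (∃ e : ℕ, t ^ p ^ e ∈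
            Ideal.span ((fun z : X₁.presheaf.stalk y => z ^ p ^ e) '' (Ideal.span (Set.range s) : Set (X₁.presheaf.stalk y)))) →
              t ∈ Ideal.span (Set.range s))) →
      -- LocFix(η): a (not necessarily 𝔪_η-primary) centre fixing η locally
      ∀ (n : ℕ) (c : Fin n → X₁.presheaf.stalk η), Ideal.span (Set.range c) ≠ ⊥ →
        Ideal.span (Set.range c) ≤ maximalIdeal (X₁.presheaf.stalk η) →
        (∀ (j : Fin n) (𝔔 : PrimeSpectrum (blowupAlgebra (Ideal.span (Set.range c)) (c j))),
          𝔔.asIdeal.comap (algebraMap (X₁.presheaf.stalk η) (blowupAlgebra (Ideal.span (Set.range c)) (c j))) =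
            maximalIdeal (X₁.presheaf.stalk η) →
          IsDomain (Localization.AtPrime 𝔔.asIdeal) ∧ ∀ d : ℕ, ringKrullDim (Localization.AtPrime 𝔔.asIdeal) = d →
            ∀ s : Fin d → Localization.AtPrime 𝔔.asIdeal, (Ideal.span (Set.range s)).radical.IsMaximal →
              RingTheory.Sequence.IsWeaklyRegular (Localization.AtPrime 𝔔.asIdeal) (List.ofFn s) ∧
              ∀ y : Localization.AtPrime 𝔔.asIdeal, (∃ e : ℕ, y ^ p ^ e ∈ Ideal.span ((fun z : Localization.AtPrime 𝔔.asIdeal => z ^ p ^ e) ''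
                (Ideal.span (Set.range s) : Set (Localization.AtPrime 𝔔.asIdeal)))) → y ∈ Ideal.span (Set.range s)) →
      -- the spread J of (c) (§C1)
      ∀ (J : X₁.IdealSheafData), J ≠ ⊥ → η ∈ (J.support : Set X₁) → stalkIdeal J η = Ideal.span (Set.range c) →
      -- FC(η, J): for every blowing up along J — FULL at the non-closed points over supp J ∖ {η}, CM at the closed points over supp J
      (∀ (X₂ : Scheme.{0}) (π : X₂ ⟶ X₁), IsBlowup π J →
        (∀ x : X₂, π.base x ∈ (J.support : Set X₁) → π.base x ≠ η → ¬ IsClosed ({x} : Set X₂) →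
          IsDomain (X₂.presheaf.stalk x) ∧ ∀ d : ℕ, ringKrullDim (X₂.presheaf.stalk x) = d → ∀ s : Fin d → X₂.presheaf.stalk x,
            (Ideal.span (Set.range s)).radical.IsMaximal → RingTheory.Sequence.IsWeaklyRegular (X₂.presheaf.stalk x) (List.ofFn s) ∧
            ∀ t : X₂.presheaf.stalk x, (∃ e : ℕ, t ^ p ^ e ∈ Ideal.span ((fun z : X₂.presheaf.stalk x => z ^ p ^ e) ''
              (Ideal.span (Set.range s) : Set (X₂.presheaf.stalk x)))) → t ∈ Ideal.span (Set.range s)) ∧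
        (∀ x : X₂, π.base x ∈ (J.support : Set X₁) → IsClosed ({x} : Set X₂) →
          ∀ d : ℕ, ringKrullDim (X₂.presheaf.stalk x) = d → ∀ s : Fin d → X₂.presheaf.stalk x,
            (Ideal.span (Set.range s)).radical.IsMaximal → RingTheory.Sequence.IsWeaklyRegular (X₂.presheaf.stalk x) (List.ofFn s))) →
      ∃ (X₂ : Scheme.{0}) (π : X₂ ⟶ X₁), IsProper π ∧ IsBirational π ∧
        IsIntegral X₂ ∧ (∀ x : X₂, (∀ d : ℕ, ringKrullDim (X₂.presheaf.stalk x) = d → ∀ s : Fin d → X₂.presheaf.stalk x,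
          (Ideal.span (Set.range s)).radical.IsMaximal → RingTheory.Sequence.IsWeaklyRegular (X₂.presheaf.stalk x) (List.ofFn s))) ∧
        ∃ (Z : Set X₁) (hZ : IsClosed Z), η ∈ Z ∧ IsIso (π ∣_ ⟨Zᶜ, hZ.isOpen_compl⟩) ∧
        ∀ x : X₂, π.base x ∈ Z → ¬ IsClosed ({x} : Set X₂) → (IsDomain (X₂.presheaf.stalk x) ∧ ∀ d : ℕ,
          ringKrullDim (X₂.presheaf.stalk x) = d → ∀ s : Fin d → X₂.presheaf.stalk x, (Ideal.span (Set.range s)).radical.IsMaximal →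
            RingTheory.Sequence.IsWeaklyRegular (X₂.presheaf.stalk x) (List.ofFn s) ∧ ∀ t : X₂.presheaf.stalk x, (∃ e : ℕ, t ^ p ^ e ∈
              Ideal.span ((fun z : X₂.presheaf.stalk x => z ^ p ^ e) '' (Ideal.span (Set.range s) : Set (X₂.presheaf.stalk x)))) →
                t ∈ Ideal.span (Set.range s))  := by
  intro p hp k _ _ X₁ f₁ hsep hft hqc hint hCM η _ n c _ _ hgood J hJ0 hηJ hJη hFC
  -- a blowing up along `J`
  obtain ⟨X₂, π, hπ⟩ := exists_isBlowup X₁ J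
  -- FULL over `η` from the local fix, and the fibre condition elsewhere over `supp J`
  have hfull := CurveStageFull.full_over_of_locFix p X₁ η n c hgood J hJη X₂ π hπ
  obtain ⟨hnc, hcl⟩ := hFC X₂ π hπ
  have hnc' : ∀ x : X₂, π.base x ∈ (J.support : Set X₁) → ¬ IsClosed ({x} : Set X₂) →
      IsDomain (X₂.presheaf.stalk x) ∧ ∀ d : ℕ, ringKrullDim (X₂.presheaf.stalk x) = d → ∀ s : Fin d → X₂.presheaf.stalk x,
        (Ideal.span (Set.range s)).radical.IsMaximal → RingTheory.Sequence.IsWeaklyRegular (X₂.presheaf.stalk x) (List.ofFn s) ∧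
        ∀ t : X₂.presheaf.stalk x, (∃ e : ℕ, t ^ p ^ e ∈ Ideal.span ((fun z : X₂.presheaf.stalk x => z ^ p ^ e) ''
          (Ideal.span (Set.range s) : Set (X₂.presheaf.stalk x)))) → t ∈ Ideal.span (Set.range s) := by
    intro x hx hxc
    by_cases h : π.base x = η
    · exact hfull x h
    · exact hnc x hx h hxc
  -- assemble with §C0
  obtain ⟨hprop, hbir, hint₂, hCM₂, Z, hZ, hηZ, hiso, hgoodZ⟩ :=
    CurveStageGlue.closedLocusStep_of_blowupDatum p hp k X₁ f₁ hsep hft hqc hint hCM η J X₂ π hJ0 hηJ hπ hnc' hcl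
  exact ⟨X₂, π, hprop, hbir, hint₂, hCM₂, Z, hZ, hηZ, hiso, hgoodZ⟩

/-- **#3β at `η` from LocFix(η) alone, given the fibre condition for every spread** — §C3 with the spread PRODUCED by §C1
`CentreSpread.centreSpread` (res-type-002, p522543): hypotheses = admissible `(X₁, f₁)`, the #3β hypothesis at `η` (verbatim,
unused), LocFix data `(n, c)`, and FC(η, J) for every ideal sheaf `J ≠ ⊥` with `η ∈ supp J`, `J_η = (c)` and every blowing up
along it. [folklore] -/
theorem closedLocusStep_of_locFix : ∀ (p : ℕ), p.Prime → ∀ (k : Type) [Field k] [CharP k p]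
    (X₁ : Scheme.{0}) (f₁ : X₁ ⟶ Spec (.of k)),
      IsSeparated f₁ → LocallyOfFiniteType f₁ → QuasiCompact f₁ → IsIntegral X₁ →
      (∀ x : X₁, (∀ d : ℕ, ringKrullDim (X₁.presheaf.stalk x) = d → ∀ s : Fin d → X₁.presheaf.stalk x,
        (Ideal.span (Set.range s)).radical.IsMaximal → RingTheory.Sequence.IsWeaklyRegular (X₁.presheaf.stalk x) (List.ofFn s))) →
      ∀ η : X₁, (¬ IsClosed ({η} : Set X₁) ∧ ¬ (∀ d : ℕ, ringKrullDim (X₁.presheaf.stalk η) = d → ∀ s : Fin d → X₁.presheaf.stalk η,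
          (Ideal.span (Set.range s)).radical.IsMaximal → ∀ t : X₁.presheaf.stalk η, (∃ e : ℕ, t ^ p ^ e ∈
            Ideal.span ((fun z : X₁.presheaf.stalk η => z ^ p ^ e) '' (Ideal.span (Set.range s) : Set (X₁.presheaf.stalk η)))) →
              t ∈ Ideal.span (Set.range s)) ∧
        ∀ y : X₁, y ⤳ η → y ≠ η → (∀ d : ℕ, ringKrullDim (X₁.presheaf.stalk y) = d → ∀ s : Fin d → X₁.presheaf.stalk y,
          (Ideal.span (Set.range s)).radical.IsMaximal → ∀ t : X₁.presheaf.stalk y, (∃ e : ℕ, t ^ p ^ e ∈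
            Ideal.span ((fun z : X₁.presheaf.stalk y => z ^ p ^ e) '' (Ideal.span (Set.range s) : Set (X₁.presheaf.stalk y)))) →
              t ∈ Ideal.span (Set.range s))) →
      -- LocFix(η): a (not necessarily 𝔪_η-primary) centre fixing η locally
      ∀ (n : ℕ) (c : Fin n → X₁.presheaf.stalk η), Ideal.span (Set.range c) ≠ ⊥ →
        Ideal.span (Set.range c) ≤ maximalIdeal (X₁.presheaf.stalk η) →
        (∀ (j : Fin n) (𝔔 : PrimeSpectrum (blowupAlgebra (Ideal.span (Set.range c)) (c j))),
          𝔔.asIdeal.comap (algebraMap (X₁.presheaf.stalk η) (blowupAlgebra (Ideal.span (Set.range c)) (c j))) =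
            maximalIdeal (X₁.presheaf.stalk η) →
          IsDomain (Localization.AtPrime 𝔔.asIdeal) ∧ ∀ d : ℕ, ringKrullDim (Localization.AtPrime 𝔔.asIdeal) = d →
            ∀ s : Fin d → Localization.AtPrime 𝔔.asIdeal, (Ideal.span (Set.range s)).radical.IsMaximal →
              RingTheory.Sequence.IsWeaklyRegular (Localization.AtPrime 𝔔.asIdeal) (List.ofFn s) ∧
              ∀ y : Localization.AtPrime 𝔔.asIdeal, (∃ e : ℕ, y ^ p ^ e ∈ Ideal.span ((fun z : Localization.AtPrime 𝔔.asIdeal => z ^ p ^ e) ''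
                (Ideal.span (Set.range s) : Set (Localization.AtPrime 𝔔.asIdeal)))) → y ∈ Ideal.span (Set.range s)) →
      -- FC(η, J) for EVERY spread J of (c) (one exists: `CentreSpread.centreSpread`, §C1) and every blowing up along J
      (∀ (J : X₁.IdealSheafData), J ≠ ⊥ → η ∈ (J.support : Set X₁) → stalkIdeal J η = Ideal.span (Set.range c) →
        ∀ (X₂ : Scheme.{0}) (π : X₂ ⟶ X₁), IsBlowup π J →
        (∀ x : X₂, π.base x ∈ (J.support : Set X₁) → π.base x ≠ η → ¬ IsClosed ({x} : Set X₂) →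
          IsDomain (X₂.presheaf.stalk x) ∧ ∀ d : ℕ, ringKrullDim (X₂.presheaf.stalk x) = d → ∀ s : Fin d → X₂.presheaf.stalk x,
            (Ideal.span (Set.range s)).radical.IsMaximal → RingTheory.Sequence.IsWeaklyRegular (X₂.presheaf.stalk x) (List.ofFn s) ∧
            ∀ t : X₂.presheaf.stalk x, (∃ e : ℕ, t ^ p ^ e ∈ Ideal.span ((fun z : X₂.presheaf.stalk x => z ^ p ^ e) ''
              (Ideal.span (Set.range s) : Set (X₂.presheaf.stalk x)))) → t ∈ Ideal.span (Set.range s)) ∧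
        (∀ x : X₂, π.base x ∈ (J.support : Set X₁) → IsClosed ({x} : Set X₂) →
          ∀ d : ℕ, ringKrullDim (X₂.presheaf.stalk x) = d → ∀ s : Fin d → X₂.presheaf.stalk x,
            (Ideal.span (Set.range s)).radical.IsMaximal → RingTheory.Sequence.IsWeaklyRegular (X₂.presheaf.stalk x) (List.ofFn s))) →
      ∃ (X₂ : Scheme.{0}) (π : X₂ ⟶ X₁), IsProper π ∧ IsBirational π ∧
        IsIntegral X₂ ∧ (∀ x : X₂, (∀ d : ℕ, ringKrullDim (X₂.presheaf.stalk x) = d → ∀ s : Fin d → X₂.presheaf.stalk x,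
          (Ideal.span (Set.range s)).radical.IsMaximal → RingTheory.Sequence.IsWeaklyRegular (X₂.presheaf.stalk x) (List.ofFn s))) ∧
        ∃ (Z : Set X₁) (hZ : IsClosed Z), η ∈ Z ∧ IsIso (π ∣_ ⟨Zᶜ, hZ.isOpen_compl⟩) ∧
        ∀ x : X₂, π.base x ∈ Z → ¬ IsClosed ({x} : Set X₂) → (IsDomain (X₂.presheaf.stalk x) ∧ ∀ d : ℕ,
          ringKrullDim (X₂.presheaf.stalk x) = d → ∀ s : Fin d → X₂.presheaf.stalk x, (Ideal.span (Set.range s)).radical.IsMaximal →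
            RingTheory.Sequence.IsWeaklyRegular (X₂.presheaf.stalk x) (List.ofFn s) ∧ ∀ t : X₂.presheaf.stalk x, (∃ e : ℕ, t ^ p ^ e ∈
              Ideal.span ((fun z : X₂.presheaf.stalk x => z ^ p ^ e) '' (Ideal.span (Set.range s) : Set (X₂.presheaf.stalk x)))) →
                t ∈ Ideal.span (Set.range s))  := by
  intro p hp k _ _ X₁ f₁ hsep hft hqc hint hCM η hη n c hc0 hcm hgood hFC
  haveI := hft
  haveI := hqc
  haveI : IsNoetherian X₁ := ClosedPointsOfClosedFinite.isNoetherian_of_locallyOfFiniteType_of_quasiCompact f₁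
  obtain ⟨J, hJ0, hηJ, hJη⟩ := CentreSpread.centreSpread X₁ η n c hc0 hcm
  exact closedLocusStep_of_locFix_of_fc p hp k X₁ f₁ hsep hft hqc hint hCM η hη n c hc0 hcm hgood J hJ0 hηJ hJη (hFC J hJ0 hηJ hJη)

end Summit.ResolutionOfSingularities.ResolutionOfSingularities.Theorems.FInjectiveMacaulayfication.CurveStageProducer

end
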